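import Mathlib
import HarnessLib
import Summits.HubbardSuperconductivity.HubbardSuperconductivity.Theorems.KLProgrammeKLRegimeEnginePairLadderInsertion

/-!
# Route `KLProgramme` — crux K3, ENGINE child (stmt-HubbardSuperconductivity-19662 `KLRegimeEngineV7` / its gen-3 successor on `klPredsV10`):
# LADDER LOCALISATION — the one-slice resummation with frequency-dependent rungs (what the tree expansion produces) against the
# resummation with localised rungs (what (E2) `PairLadderStepAtV7` reads), complex slice weights throughout

Cell gate-hubbard-kl, seat hubbard-kl-k3c1-p1 (g2; technique «composed-map remainder propagation»); sequel to p461056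
`…EnginePairLadderInsertion` (true weights → model weights) and p457092 `…CooperResummationSingleSlice`.  The one-scale tree expansion of
`stub_engine_step_values` expresses the pair-ladder part of the scale-`n` pair amplitude as the resummation `Σ_j K(−diag z′·K)^j` on the carrier
`S′ = S × F` (momentum × slice Matsubara index), whose RUNGS `K((p,ν),(p′,ν′))` are the scale-`(n−1)` quartic kernels at the internal frequencies
and whose weights `z′_(p,ν) = β⁻¹ĝ_n(ν,p)ĝ_n(−ν,Qm−p)` are single propagator pairs; the clause reads the ladder of the LOCALISED rung
`C = 𝒞_{n−1}(Qm)` (all frequencies at `±ω₀`) on `S` with the aggregated slice bubble `z_p = Σ_ν z′_(p,ν)`.  Two composed-map steps close the gap: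

§1 (one carrier, pure linear algebra): **`klell_kernel_perturbation`** — for kernels `K`, `C` with `|C| ≤ m`, `|K| ≤ m′`, the SAME complex weights
`z` (`m·Σ|z| ≤ 1/3`, `m′·Σ|z| ≤ 1/3`) and the two ladder sums `T_K`, `T_C`, with `E = K − C`:
`|T_K(x,y) − T_C(x,y)| ≤ |E(x,y)| + (3/2)m·Σ_b |E(x,b)||z_b| + (3/2)m′·Σ_a |z_a||E(a,y)| + (9/4)m′m·Σ_{a,b} |z_a||E(a,b)||z_b|` (resolvent identity
`N₀ᴷK − N₀ᶜC = (1 − R_K·D)·E·(1 − D·R_C)`; the weighted sums only see `E` next to a weight, i.e. on the slice support, and the unweighted term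
is `E` at the external entry, which VANISHES for the frequency localisation at `±ω₀`); the uniform corollary `klell_kernel_perturbation_unif`
(`|E| ≤ ε` next to the weight support ⟹ `≤ |E(x,y)| + (5/4)·ε`).
§2 (product carrier `S × F`): `klell_submatrix_mul_diagonal_mul`, `klell_submatrix_ladder_pow` — a ladder whose rungs do not read the `F`-coordinate,
`C.submatrix fst fst`, IS the ladder of `C` with the aggregated weights `z_s = Σ_b z′_(s,b)`: `Ĉ(−diag z′·Ĉ)^j = (C(−diag z·C)^j).submatrix fst fst`;
`klell_ladder_hasSum_lift`; `klell_sum_norm_aggregate_le` (`Σ_s|z_s| ≤ Σ|z′|`).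
§3 (composition): **`klell_localised_ladder`** — from `|C| ≤ m` on `S`, `|K| ≤ m′` on `S × F`, the weights' smallness and the `K`-ladder sum `T_K`,
there is `T` on `S` summing the `C`-ladder with the aggregated weights and `|T_K(x,y) − T(x.1,y.1)| ≤` the four-term bound with
`E = K − C.submatrix fst fst`.  §4 (model): **`pairLadderStepAtV7_of_expansion`** — (E2-v7) at `1 ≤ n` from expansion-level data per pair class:
the rung array `K`, single-pair weights `z′` (`Σ|z′| ≤ bhi`), a model `w ≥ 0` (`Σ w ≤ bhi`), the `K`-ladder sum `T_K`, the non-ladder bound `e₀`,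
the localisation bound `e_loc` on the four-term expression at the external entries, and the accounting `e₀ + e_loc + (9/4)(2|U| + DU²)²·Σ|z − w| ≤ eremBar`.
Everything is proved; no definitions; nothing about the model is asserted beyond these implications.  0 kit.
-/

noncomputable section

namespace Summit.HubbardSuperconductivity.HubbardSuperconductivity.Theorems.KLRegimeSplit

set_option linter.dupNamespace false -- summit = problem name (single-conjunct summit), D-0017

open Finset Matrix Literature.MathematicalPhysics.QuantumLattice Literature.Probability.LatticeModels
open Summit.HubbardSuperconductivity.HubbardSuperconductivity.Theorems.KLProgrammeCooperResummation

/-! ## §1 Kernel perturbation of the one-slice resummation (complex weights, one carrier) -/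

section Kernel

variable {S : Type*} [Fintype S] [DecidableEq S]

/-- Entries of `A·diag z·B`: `|(A·diag z·B)(x,y)| ≤ Σ_a |A(x,a)|·|z_a|·|B(a,y)|`. -/
theorem klell_norm_mul_diag_mul_apply_le (A B : Matrix S S ℂ) (z : S → ℂ) (x y : S) :
    ‖(A * Matrix.diagonal z * B) x y‖ ≤ ∑ a, ‖A x a‖ * ‖z a‖ * ‖B a y‖ := by
  rw [Matrix.mul_apply]
  refine (norm_sum_le _ _).trans (le_of_eq (sum_congr rfl fun a _ => ?_))
  rw [Matrix.mul_diagonal, norm_mul, norm_mul]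

/-- **The resolvent identity with explicit one-sided inverses.**  `N₀ᴷ·(1 + K·D) = 1`, `(1 + C·D)·N₀ᶜ = 1` ⟹
`N₀ᴷ·K − N₀ᶜ·C = N₀ᴷ·(K − C)·(1 − D·(N₀ᶜ·C))`. -/
theorem klell_resummed_sub_identity (K C D N₀K N₀C : Matrix S S ℂ) (hK : N₀K * (1 + K * D) = 1)
    (hC : (1 + C * D) * N₀C = 1) : N₀K * K - N₀C * C = N₀K * (K - C) * (1 - D * (N₀C * C)) := by
  symm
  calc N₀K * (K - C) * (1 - D * (N₀C * C))
      = N₀K * (K - C) - (N₀K * (1 + K * D) * N₀C - N₀K * ((1 + C * D) * N₀C)) * C := by noncomm_ring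
    _ = N₀K * (K - C) - (1 * N₀C - N₀K * 1) * C := by rw [hK, hC]
    _ = N₀K * K - N₀C * C := by noncomm_ring

variable [Nonempty S]

/-- **Kernel perturbation of the one-slice resummation (weighted form).**  Kernels `K`, `C` with `|C| ≤ m`, `|K| ≤ m′`; the SAME complex weights
`z` with `m·Σ|z| ≤ 1/3` and `m′·Σ|z| ≤ 1/3`; `T_K`, `T_C` the two ladder sums (`HasSum (j ↦ X(−diag z·X)^j) T_X`).  With `E = K − C`:
`|T_K(x,y) − T_C(x,y)| ≤ |E(x,y)| + (3/2)m·Σ_b |E(x,b)|·|z_b| + (3/2)m′·Σ_a |z_a|·|E(a,y)| + (9/4)m′m·Σ_a Σ_b |z_a|·|E(a,b)|·|z_b|`. -/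
theorem klell_kernel_perturbation (K C : Matrix S S ℂ) (z : S → ℂ) {m m' : ℝ} (hm : 0 ≤ m) (hm' : 0 ≤ m')
    (hC : ∀ x y, ‖C x y‖ ≤ m) (hK : ∀ x y, ‖K x y‖ ≤ m') (hzC : m * ∑ a, ‖z a‖ ≤ 1 / 3) (hzK : m' * ∑ a, ‖z a‖ ≤ 1 / 3)
    (TK TC : Matrix S S ℂ) (hTK : HasSum (fun j : ℕ => K * (-(Matrix.diagonal z * K)) ^ j) TK)
    (hTC : HasSum (fun j : ℕ => C * (-(Matrix.diagonal z * C)) ^ j) TC) (x y : S) :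
    ‖TK x y - TC x y‖ ≤ ‖(K - C) x y‖ + 3 / 2 * m * ∑ b, ‖(K - C) x b‖ * ‖z b‖ + 3 / 2 * m' * ∑ a, ‖z a‖ * ‖(K - C) a y‖ +
      9 / 4 * m' * m * ∑ a, ∑ b, ‖z a‖ * ‖(K - C) a b‖ * ‖z b‖ := by
  set D : Matrix S S ℂ := Matrix.diagonal z with hD_def
  set E : Matrix S S ℂ := K - C with hE_def
  -- the inverses of `klcrs_single_slice` and the identification of the ladder sums
  obtain ⟨NK, N₀K, hNK1, -, -, hN₀K2, hpushK, -, -, hRK, -, -⟩ := klcrs_single_slice z hm' K hK hzK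
  obtain ⟨NC, N₀C, hNC1, -, hN₀C1, -, hpushC, -, -, hRC, -, -⟩ := klcrs_single_slice z hm C hC hzC
  have hTK' : TK = K * NK := hTK.unique (klcrs_single_slice_ladder_hasSum z hm' K hK hzK NK hNK1).2
  have hTC' : TC = C * NC := hTC.unique (klcrs_single_slice_ladder_hasSum z hm C hC hzC NC hNC1).2
  -- `R_K = N₀ᴷ K = K N_K`, `R_C = N₀ᶜ C = C N_C`; `N₀ᴷ = 1 − R_K D`
  set RK : Matrix S S ℂ := K * NK with hRK_def
  set RC : Matrix S S ℂ := C * NC with hRC_def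
  have hN₀K : N₀K = 1 - RK * D := by
    calc N₀K = N₀K * (1 + K * D) - N₀K * K * D := by noncomm_ring
      _ = 1 - RK * D := by rw [hN₀K2, hpushK]
  have hid : RK - RC = E - E * D * RC - RK * D * E + RK * D * (E * D * RC) := by
    have h1 := klell_resummed_sub_identity K C D N₀K N₀C hN₀K2 hN₀C1
    rw [← hpushK, ← hpushC] at h1
    rw [h1, hN₀K, hE_def]
    noncomm_ring
  -- entry bounds of the three correction terms
  have hT2 : ‖(E * D * RC) x y‖ ≤ 3 / 2 * m * ∑ b, ‖E x b‖ * ‖z b‖ := by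
    refine (klell_norm_mul_diag_mul_apply_le E RC z x y).trans ?_
    rw [Finset.mul_sum]
    exact sum_le_sum fun b _ => by
      calc ‖E x b‖ * ‖z b‖ * ‖RC b y‖ ≤ ‖E x b‖ * ‖z b‖ * (3 / 2 * m) :=
            mul_le_mul_of_nonneg_left (hRC b y) (by positivity)
        _ = 3 / 2 * m * (‖E x b‖ * ‖z b‖) := by ring
  have hT2' : ∀ a, ‖(E * D * RC) a y‖ ≤ 3 / 2 * m * ∑ b, ‖E a b‖ * ‖z b‖ := by
    intro a
    refine (klell_norm_mul_diag_mul_apply_le E RC z a y).trans ?_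
    rw [Finset.mul_sum]
    exact sum_le_sum fun b _ => by
      calc ‖E a b‖ * ‖z b‖ * ‖RC b y‖ ≤ ‖E a b‖ * ‖z b‖ * (3 / 2 * m) :=
            mul_le_mul_of_nonneg_left (hRC b y) (by positivity)
        _ = 3 / 2 * m * (‖E a b‖ * ‖z b‖) := by ring
  have hT3 : ‖(RK * D * E) x y‖ ≤ 3 / 2 * m' * ∑ a, ‖z a‖ * ‖E a y‖ := by
    refine (klell_norm_mul_diag_mul_apply_le RK E z x y).trans ?_
    rw [Finset.mul_sum]
    exact sum_le_sum fun a _ => by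
      calc ‖RK x a‖ * ‖z a‖ * ‖E a y‖ ≤ 3 / 2 * m' * ‖z a‖ * ‖E a y‖ :=
            mul_le_mul_of_nonneg_right (mul_le_mul_of_nonneg_right (hRK x a) (norm_nonneg _)) (norm_nonneg _)
        _ = 3 / 2 * m' * (‖z a‖ * ‖E a y‖) := by ring
  have hT4 : ‖(RK * D * (E * D * RC)) x y‖ ≤ 9 / 4 * m' * m * ∑ a, ∑ b, ‖z a‖ * ‖E a b‖ * ‖z b‖ := by
    refine (klell_norm_mul_diag_mul_apply_le RK (E * D * RC) z x y).trans ?_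
    calc ∑ a, ‖RK x a‖ * ‖z a‖ * ‖(E * D * RC) a y‖
        ≤ ∑ a, 3 / 2 * m' * ‖z a‖ * (3 / 2 * m * ∑ b, ‖E a b‖ * ‖z b‖) := sum_le_sum fun a _ =>
          mul_le_mul (mul_le_mul_of_nonneg_right (hRK x a) (norm_nonneg _)) (hT2' a) (norm_nonneg _) (by positivity)
      _ = 9 / 4 * m' * m * ∑ a, ∑ b, ‖z a‖ * ‖E a b‖ * ‖z b‖ := by
          rw [Finset.mul_sum]
          refine sum_congr rfl fun a _ => ?_
          rw [Finset.mul_sum, Finset.mul_sum, Finset.mul_sum]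
          exact sum_congr rfl fun b _ => by ring
  -- assemble
  rw [hTK', hTC', ← Matrix.sub_apply, show K * NK - C * NC = RK - RC from rfl, hid]
  simp only [Matrix.add_apply, Matrix.sub_apply]
  have n1 := norm_add_le (E x y - (E * D * RC) x y - (RK * D * E) x y) ((RK * D * (E * D * RC)) x y)
  have n2 := norm_sub_le (E x y - (E * D * RC) x y) ((RK * D * E) x y)
  have n3 := norm_sub_le (E x y) ((E * D * RC) x y)
  linarith

/-- **Kernel perturbation, uniform form.**  If, in addition, `|E(a,b)| ≤ ε` whenever `z_a ≠ 0` or `z_b ≠ 0` (the perturbation is `ε`-small next to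
the weight support — nothing is asked away from it), then `|T_K(x,y) − T_C(x,y)| ≤ |E(x,y)| + (5/4)·ε`. -/
theorem klell_kernel_perturbation_unif (K C : Matrix S S ℂ) (z : S → ℂ) {m m' ε : ℝ} (hm : 0 ≤ m) (hm' : 0 ≤ m') (hε : 0 ≤ ε)
    (hC : ∀ x y, ‖C x y‖ ≤ m) (hK : ∀ x y, ‖K x y‖ ≤ m') (hzC : m * ∑ a, ‖z a‖ ≤ 1 / 3) (hzK : m' * ∑ a, ‖z a‖ ≤ 1 / 3)
    (hEcol : ∀ a b, z b ≠ 0 → ‖(K - C) a b‖ ≤ ε) (hErow : ∀ a b, z a ≠ 0 → ‖(K - C) a b‖ ≤ ε)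
    (TK TC : Matrix S S ℂ) (hTK : HasSum (fun j : ℕ => K * (-(Matrix.diagonal z * K)) ^ j) TK)
    (hTC : HasSum (fun j : ℕ => C * (-(Matrix.diagonal z * C)) ^ j) TC) (x y : S) :
    ‖TK x y - TC x y‖ ≤ ‖(K - C) x y‖ + 5 / 4 * ε := by
  have h := klell_kernel_perturbation K C z hm hm' hC hK hzC hzK TK TC hTK hTC x y
  set Z : ℝ := ∑ a, ‖z a‖ with hZ_def
  have hZ : 0 ≤ Z := sum_nonneg fun a _ => norm_nonneg _
  -- each weighted sum is at most `ε·Z` (resp. `ε·Z²`)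
  have hwt : ∀ a b, ‖(K - C) a b‖ * ‖z b‖ ≤ ε * ‖z b‖ := by
    intro a b
    by_cases hb : z b = 0
    · simp [hb]
    · exact mul_le_mul_of_nonneg_right (hEcol a b hb) (norm_nonneg _)
  have hwt' : ∀ a b, ‖z a‖ * ‖(K - C) a b‖ ≤ ‖z a‖ * ε := by
    intro a b
    by_cases ha : z a = 0
    · simp [ha]
    · exact mul_le_mul_of_nonneg_left (hErow a b ha) (norm_nonneg _)
  have h2 : ∑ b, ‖(K - C) x b‖ * ‖z b‖ ≤ ε * Z := by
    rw [hZ_def, Finset.mul_sum]; exact sum_le_sum fun b _ => hwt x b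
  have h3 : ∑ a, ‖z a‖ * ‖(K - C) a y‖ ≤ Z * ε := by
    rw [hZ_def, Finset.sum_mul]; exact sum_le_sum fun a _ => hwt' a y
  have h4 : ∑ a, ∑ b, ‖z a‖ * ‖(K - C) a b‖ * ‖z b‖ ≤ Z * ε * Z := by
    rw [hZ_def, Finset.sum_mul, Finset.sum_mul]
    refine sum_le_sum fun a _ => ?_
    rw [Finset.mul_sum]
    refine sum_le_sum fun b _ => ?_
    exact mul_le_mul_of_nonneg_right (hwt' a b) (norm_nonneg _)
  have hmZ : m * Z ≤ 1 / 3 := hzC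
  have hm'Z : m' * Z ≤ 1 / 3 := hzK
  have e2 : 3 / 2 * m * ∑ b, ‖(K - C) x b‖ * ‖z b‖ ≤ 1 / 2 * ε := by
    calc 3 / 2 * m * ∑ b, ‖(K - C) x b‖ * ‖z b‖ ≤ 3 / 2 * m * (ε * Z) := mul_le_mul_of_nonneg_left h2 (by positivity)
      _ = 3 / 2 * (m * Z) * ε := by ring
      _ ≤ 3 / 2 * (1 / 3) * ε := by gcongr
      _ = 1 / 2 * ε := by ring
  have e3 : 3 / 2 * m' * ∑ a, ‖z a‖ * ‖(K - C) a y‖ ≤ 1 / 2 * ε := by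
    calc 3 / 2 * m' * ∑ a, ‖z a‖ * ‖(K - C) a y‖ ≤ 3 / 2 * m' * (Z * ε) := mul_le_mul_of_nonneg_left h3 (by positivity)
      _ = 3 / 2 * (m' * Z) * ε := by ring
      _ ≤ 3 / 2 * (1 / 3) * ε := by gcongr
      _ = 1 / 2 * ε := by ring
  have e4 : 9 / 4 * m' * m * ∑ a, ∑ b, ‖z a‖ * ‖(K - C) a b‖ * ‖z b‖ ≤ 1 / 4 * ε := by
    calc 9 / 4 * m' * m * ∑ a, ∑ b, ‖z a‖ * ‖(K - C) a b‖ * ‖z b‖ ≤ 9 / 4 * m' * m * (Z * ε * Z) :=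
          mul_le_mul_of_nonneg_left h4 (by positivity)
      _ = 9 / 4 * (m' * Z) * (m * Z) * ε := by ring
      _ ≤ 9 / 4 * (1 / 3) * (1 / 3) * ε := by gcongr
      _ = 1 / 4 * ε := by ring
  linarith

end Kernel

/-! ## §2 Product carrier: rungs that do not read the second coordinate -/

section Product

variable {S F : Type*} [Fintype S] [DecidableEq S] [Fintype F] [DecidableEq F]

/-- **Aggregation identity.**  For `A`, `B` on `S` lifted to `S × F` along `fst` and weights `z′` on `S × F`:
`Â·diag z′·B̂ = (A·diag z·B)^` with the aggregated weights `z_s = Σ_b z′_(s,b)`. -/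
theorem klell_submatrix_mul_diagonal_mul (A B : Matrix S S ℂ) (z' : S × F → ℂ) :
    A.submatrix Prod.fst Prod.fst * Matrix.diagonal z' * B.submatrix Prod.fst Prod.fst =
      (A * Matrix.diagonal (fun s => ∑ b, z' (s, b)) * B).submatrix Prod.fst Prod.fst := by
  ext x y
  rw [Matrix.submatrix_apply, Matrix.mul_apply, Matrix.mul_apply, Fintype.sum_prod_type]
  refine sum_congr rfl fun s _ => ?_
  simp only [Matrix.mul_diagonal, Matrix.submatrix_apply, Finset.mul_sum, Finset.sum_mul]

/-- **The lifted ladder is the aggregated ladder**: `Ĉ·(−diag z′·Ĉ)^j = (C·(−diag z·C)^j)^` for every `j`. -/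
theorem klell_submatrix_ladder_pow (C : Matrix S S ℂ) (z' : S × F → ℂ) (j : ℕ) :
    C.submatrix Prod.fst Prod.fst * (-(Matrix.diagonal z' * C.submatrix Prod.fst Prod.fst)) ^ j =
      (C * (-(Matrix.diagonal (fun s => ∑ b, z' (s, b)) * C)) ^ j).submatrix Prod.fst Prod.fst := by
  induction j with
  | zero => simp
  | succ j ih =>
      have hneg : ∀ A : Matrix S S ℂ,
          ((-A).submatrix Prod.fst Prod.fst : Matrix (S × F) (S × F) ℂ) = -A.submatrix Prod.fst Prod.fst := fun A => rfl
      rw [pow_succ, ← Matrix.mul_assoc, ih, Matrix.mul_neg, ← Matrix.mul_assoc, klell_submatrix_mul_diagonal_mul,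
        pow_succ, ← Matrix.mul_assoc (C : Matrix S S ℂ), Matrix.mul_neg, ← Matrix.mul_assoc, hneg]

/-- **Lift of the ladder sum**: if `T` sums the aggregated ladder on `S`, then `T^ = T.submatrix fst fst` sums the lifted ladder on `S × F`. -/
theorem klell_ladder_hasSum_lift (C : Matrix S S ℂ) (z' : S × F → ℂ) (T : Matrix S S ℂ)
    (hT : HasSum (fun j : ℕ => C * (-(Matrix.diagonal (fun s => ∑ b, z' (s, b)) * C)) ^ j) T) :
    HasSum (fun j : ℕ => C.submatrix Prod.fst Prod.fst * (-(Matrix.diagonal z' * C.submatrix Prod.fst Prod.fst)) ^ j)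
      (T.submatrix Prod.fst Prod.fst) := by
  refine Pi.hasSum.2 fun x => Pi.hasSum.2 fun y => ?_
  have h := Pi.hasSum.1 (Pi.hasSum.1 hT x.1) y.1
  refine h.congr_fun fun j => ?_
  rw [klell_submatrix_ladder_pow]
  rfl

omit [DecidableEq S] [DecidableEq F] in
/-- The aggregated weights have mass at most the total mass: `Σ_s |Σ_b z′_(s,b)| ≤ Σ_(s,b) |z′_(s,b)|`. -/
theorem klell_sum_norm_aggregate_le (z' : S × F → ℂ) : ∑ s, ‖∑ b, z' (s, b)‖ ≤ ∑ x, ‖z' x‖ := by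
  rw [Fintype.sum_prod_type]
  exact sum_le_sum fun s _ => norm_sum_le _ _

omit [Fintype S] [DecidableEq S] [Fintype F] [DecidableEq F] in
/-- Entries of the lift: `|Ĉ(x,y)| ≤ m` from `|C| ≤ m`. -/
theorem klell_submatrix_entry_le (C : Matrix S S ℂ) {m : ℝ} (hC : ∀ s t, ‖C s t‖ ≤ m) (x y : S × F) :
    ‖C.submatrix Prod.fst Prod.fst x y‖ ≤ m := hC x.1 y.1

end Product

/-! ## §3 Composition: the expansion's ladder against the localised aggregated ladder -/

section Compose

variable {S F : Type*} [Fintype S] [DecidableEq S] [Nonempty S] [Fintype F] [DecidableEq F] [Nonempty F]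

/-- **The localised ladder.**  `C` on `S` with `|C| ≤ m`; `K` on `S × F` with `|K| ≤ m′`; weights `z′` on `S × F` with `m·Σ|z′| ≤ 1/3`,
`m′·Σ|z′| ≤ 1/3`; `T_K` the `K`-ladder sum.  Then there is `T` on `S` summing the `C`-ladder with the AGGREGATED weights `z_s = Σ_b z′_(s,b)`, and
for all `x y : S × F`, with `E = K − C.submatrix fst fst`:
`|T_K(x,y) − T(x.1,y.1)| ≤ |E(x,y)| + (3/2)m·Σ_b |E(x,b)||z′_b| + (3/2)m′·Σ_a |z′_a||E(a,y)| + (9/4)m′m·Σ_a Σ_b |z′_a||E(a,b)||z′_b|`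
(entries written out: `E(x,y) = K(x,y) − C(x.1,y.1)`). -/
theorem klell_localised_ladder (C : Matrix S S ℂ) (K : Matrix (S × F) (S × F) ℂ) (z' : S × F → ℂ) {m m' : ℝ}
    (hm : 0 ≤ m) (hm' : 0 ≤ m') (hC : ∀ s t, ‖C s t‖ ≤ m) (hK : ∀ x y, ‖K x y‖ ≤ m')
    (hzC : m * ∑ x, ‖z' x‖ ≤ 1 / 3) (hzK : m' * ∑ x, ‖z' x‖ ≤ 1 / 3)
    (TK : Matrix (S × F) (S × F) ℂ) (hTK : HasSum (fun j : ℕ => K * (-(Matrix.diagonal z' * K)) ^ j) TK) :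
    ∃ T : Matrix S S ℂ, HasSum (fun j : ℕ => C * (-(Matrix.diagonal (fun s => ∑ b, z' (s, b)) * C)) ^ j) T ∧
      ∀ x y : S × F,
        ‖TK x y - T x.1 y.1‖ ≤ ‖K x y - C x.1 y.1‖ +
          3 / 2 * m * ∑ b, ‖K x b - C x.1 b.1‖ * ‖z' b‖ +
          3 / 2 * m' * ∑ a, ‖z' a‖ * ‖K a y - C a.1 y.1‖ +
          9 / 4 * m' * m * ∑ a, ∑ b, ‖z' a‖ * ‖K a b - C a.1 b.1‖ * ‖z' b‖ := by
  set z : S → ℂ := fun s => ∑ b, z' (s, b) with hz_def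
  have hzS : m * ∑ s, ‖z s‖ ≤ 1 / 3 :=
    (mul_le_mul_of_nonneg_left (klell_sum_norm_aggregate_le z') hm).trans hzC
  -- the aggregated ladder on `S` converges to `C·N`
  obtain ⟨N, -, hN1, -, -, -, -, -, -, -, -, -⟩ := klcrs_single_slice z hm C hC hzS
  have hT := (klcrs_single_slice_ladder_hasSum z hm C hC hzS N hN1).2
  refine ⟨C * N, hT, fun x y => ?_⟩
  -- lift it to `S × F` and compare with the `K`-ladder there
  have hlift := klell_ladder_hasSum_lift C z' (C * N) hT
  have hĈ : ∀ x y : S × F, ‖C.submatrix Prod.fst Prod.fst x y‖ ≤ m := klell_submatrix_entry_le C hC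
  have h := klell_kernel_perturbation K (C.submatrix Prod.fst Prod.fst) z' hm hm' hĈ hK hzC hzK TK
    ((C * N).submatrix Prod.fst Prod.fst) hTK hlift x y
  simpa only [Matrix.sub_apply, Matrix.submatrix_apply] using h

end Compose

/-! ## §4 Model: (E2) at `1 ≤ n` from expansion-level data -/

section Model

variable (L M : ℕ) [NeZero L] [NeZero M]
variable {F : Type*} [Fintype F] [DecidableEq F] [Nonempty F]

/-- **The `hsup` data of `klpli_succ_conjunct` from expansion-level data** (generic in the leg-count token `cnt`).  Fix the slice-frequency index
type `F` and the external index `a₀ : F` (the lowest Matsubara pair `±ω₀`).  Per pair-class `Qm` the engine supplies: the rung array `K` on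
`TorusSite 2 L × F` (scale-`(n−1)` quartic kernels at the internal legs; `|K| ≤ m′`, `m′·Σ|z′| ≤ 1/3`), the single-pair weights `z′` (`Σ|z′| ≤ bhi`),
a model `w ≥ 0` on `TorusSite 2 L` (`Σ w ≤ bhi`), the `K`-ladder sum `T_K`, the NON-LADDER bound
`‖𝒞_n(Qm)(k,k′) − T_K((k,a₀),(k′,a₀))‖ ≤ drivePBar + e₀ + thermalBar + legDressBarQ·cnt` on the ball, the LOCALISATION bound `e_loc` on the four-term
expression of `klell_localised_ladder` at the external entries (with `C = 𝒞_{n−1}(Qm)`, `m = 2|U| + D·U²`; its unweighted term is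
`K((k,a₀),(k′,a₀)) − 𝒞_{n−1}(Qm)(k,k′)`, zero for the frequency localisation), and the accounting
`e₀ + e_loc + (9/4)(2|U| + D·U²)²·Σ_p |Σ_b z′_(p,b) − w_p| ≤ eremBar G P Q U β L (n−1)`.  Output: the per-`Qm` data `(z, w, T, e₁)` of
`klpli_succ_conjunct` with the aggregated `z_p = Σ_b z′_(p,b)` and `e₁ = e₀ + e_loc`. -/
theorem klell_hsup_of_expansion {G : GeoConsts} {P : SplitConsts} {Q : EngConsts} {β U μ : ℝ} {K₀ : TrigPolyC4v} {n : ℕ}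
    (cnt : ℕ → (Fin 4 → TorusSite 2 L) → ℕ) (a₀ : F)
    (hsplit : PairArrayAtV2 L M P Q β U μ K₀ (n - 1)) (hD : 0 ≤ P.C_W + klLegKappa * Q.CR * P.Klam ^ 3)
    (hsmall : G.bhi * (2 * |U| + (P.C_W + klLegKappa * Q.CR * P.Klam ^ 3) * U ^ 2) ≤ 1 / 3)
    (hexp : ∀ Qm : TorusSite 2 L, IsPairClassAt L Qm n →
      ∃ (K : Matrix (TorusSite 2 L × F) (TorusSite 2 L × F) ℂ) (z' : TorusSite 2 L × F → ℂ) (w : TorusSite 2 L → ℝ)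
        (TK : Matrix (TorusSite 2 L × F) (TorusSite 2 L × F) ℂ) (m' e₀ eloc : ℝ),
        0 ≤ m' ∧ (∀ x y, ‖K x y‖ ≤ m') ∧ m' * ∑ x, ‖z' x‖ ≤ 1 / 3 ∧ ∑ x, ‖z' x‖ ≤ G.bhi ∧
        (∀ p, 0 ≤ w p) ∧ ∑ p, w p ≤ G.bhi ∧
        HasSum (fun j : ℕ => K * (-(Matrix.diagonal z' * K)) ^ j) TK ∧
        (∀ k ∈ klBall L μ K₀, ∀ k' ∈ klBall L μ K₀,
          ‖klPairAmplitude L M β U μ K₀ n Qm k k' - TK (k, a₀) (k', a₀)‖ ≤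
            drivePBar G P U (n - 1) + e₀ + thermalBar G P U β n + legDressBarQ G P Q U n (cnt n ![k', Qm - k', Qm - k, k])) ∧
        (∀ k ∈ klBall L μ K₀, ∀ k' ∈ klBall L μ K₀,
          ‖K (k, a₀) (k', a₀) - klPairArray L M β U μ K₀ (n - 1) Qm k k'‖ +
            3 / 2 * (2 * |U| + (P.C_W + klLegKappa * Q.CR * P.Klam ^ 3) * U ^ 2) *
              ∑ b, ‖K (k, a₀) b - klPairArray L M β U μ K₀ (n - 1) Qm k b.1‖ * ‖z' b‖ +
            3 / 2 * m' * ∑ a, ‖z' a‖ * ‖K a (k', a₀) - klPairArray L M β U μ K₀ (n - 1) Qm a.1 k'‖ +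
            9 / 4 * m' * (2 * |U| + (P.C_W + klLegKappa * Q.CR * P.Klam ^ 3) * U ^ 2) *
              ∑ a, ∑ b, ‖z' a‖ * ‖K a b - klPairArray L M β U μ K₀ (n - 1) Qm a.1 b.1‖ * ‖z' b‖ ≤ eloc) ∧
        e₀ + eloc + 9 / 4 * (2 * |U| + (P.C_W + klLegKappa * Q.CR * P.Klam ^ 3) * U ^ 2) ^ 2 *
            ∑ p, ‖(∑ b, z' (p, b)) - (w p : ℂ)‖ ≤ eremBar G P Q U β L (n - 1)) :
    ∀ Qm : TorusSite 2 L, IsPairClassAt L Qm n →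
      ∃ (z : TorusSite 2 L → ℂ) (w : TorusSite 2 L → ℝ) (T : Matrix (TorusSite 2 L) (TorusSite 2 L) ℂ) (e₁ : ℝ),
        (∀ p, 0 ≤ w p) ∧ (∑ p, w p ≤ G.bhi) ∧ (∑ p, ‖z p‖ ≤ G.bhi) ∧
        HasSum (fun i : ℕ => klPairArray L M β U μ K₀ (n - 1) Qm *
          (-(Matrix.diagonal z * klPairArray L M β U μ K₀ (n - 1) Qm)) ^ i) T ∧
        e₁ + 9 / 4 * (2 * |U| + (P.C_W + klLegKappa * Q.CR * P.Klam ^ 3) * U ^ 2) ^ 2 * ∑ p, ‖z p - (w p : ℂ)‖ ≤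
          eremBar G P Q U β L (n - 1) ∧
        ∀ k ∈ klBall L μ K₀, ∀ k' ∈ klBall L μ K₀,
          ‖klPairAmplitude L M β U μ K₀ n Qm k k' - T k k'‖ ≤
            drivePBar G P U (n - 1) + e₁ + thermalBar G P U β n +
              legDressBarQ G P Q U n (cnt n ![k', Qm - k', Qm - k, k]) := by
  intro Qm hQm
  obtain ⟨K, z', w, TK, m', e₀, eloc, hm', hK, hzK, hzsum, hw, hwsum, hTK, hA, hloc, hacc⟩ := hexp Qm hQm
  set m : ℝ := 2 * |U| + (P.C_W + klLegKappa * Q.CR * P.Klam ^ 3) * U ^ 2 with hm_def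
  have hm : 0 ≤ m := by
    have : 0 ≤ (P.C_W + klLegKappa * Q.CR * P.Klam ^ 3) * U ^ 2 := mul_nonneg hD (sq_nonneg U)
    have : 0 ≤ |U| := abs_nonneg U
    linarith
  have hC : ∀ s t, ‖klPairArray L M β U μ K₀ (n - 1) Qm s t‖ ≤ m := fun s t => klpli_pairArray_entry_le L M hsplit hD Qm s t
  have hzC : m * ∑ x, ‖z' x‖ ≤ 1 / 3 :=
    calc m * ∑ x, ‖z' x‖ ≤ m * G.bhi := mul_le_mul_of_nonneg_left hzsum hm
      _ = G.bhi * m := mul_comm _ _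
      _ ≤ 1 / 3 := hsmall
  obtain ⟨T, hT, hbd⟩ := klell_localised_ladder (klPairArray L M β U μ K₀ (n - 1) Qm) K z' hm hm' hC hK hzC hzK TK hTK
  refine ⟨fun p => ∑ b, z' (p, b), w, T, e₀ + eloc, hw, hwsum, (klell_sum_norm_aggregate_le z').trans hzsum, hT, ?_, ?_⟩
  · linarith
  · intro k hk k' hk'
    have h1 := hA k hk k' hk'
    have h2 := (hbd (k, a₀) (k', a₀)).trans (hloc k hk k' hk')
    calc ‖klPairAmplitude L M β U μ K₀ n Qm k k' - T k k'‖
        = ‖(klPairAmplitude L M β U μ K₀ n Qm k k' - TK (k, a₀) (k', a₀)) + (TK (k, a₀) (k', a₀) - T k k')‖ := by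
          rw [sub_add_sub_cancel]
      _ ≤ ‖klPairAmplitude L M β U μ K₀ n Qm k k' - TK (k, a₀) (k', a₀)‖ + ‖TK (k, a₀) (k', a₀) - T k k'‖ := norm_add_le _ _
      _ ≤ drivePBar G P U (n - 1) + (e₀ + eloc) + thermalBar G P U β n +
            legDressBarQ G P Q U n (cnt n ![k', Qm - k', Qm - k, k]) := by linarith

/-- **(E2-v7) at `1 ≤ n` from expansion-level data** (gen-3 bundle `klPredsV10`): `PairLadderStepAtV7 L M G P Q β U μ K n` from the history's split
slot `PairArrayAtV2 … (n−1)`, the `U`-smallness `G.bhi·(2|U| + D·U²) ≤ 1/3`, and per pair class the data of `klell_hsup_of_expansion` at the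
temperature-aware count `legSliceCountT L β μ K` — composition `klell_hsup_of_expansion` → `klpli_succ_conjunct`; the ultraviolet conjunct is
vacuous at `1 ≤ n`.  (For the V8/V9 clause `PairLadderStepAtV6` use the same two lemmas verbatim; for V7's `PairLadderStepAtV5` with
`cnt := legSliceCount L μ K`.) -/
theorem pairLadderStepAtV7_of_expansion {G : GeoConsts} {P : SplitConsts} {Q : EngConsts} {β U μ : ℝ} {K₀ : TrigPolyC4v} {n : ℕ}
    (a₀ : F) (hn : 1 ≤ n)
    (hsplit : PairArrayAtV2 L M P Q β U μ K₀ (n - 1)) (hD : 0 ≤ P.C_W + klLegKappa * Q.CR * P.Klam ^ 3)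
    (hsmall : G.bhi * (2 * |U| + (P.C_W + klLegKappa * Q.CR * P.Klam ^ 3) * U ^ 2) ≤ 1 / 3)
    (hexp : ∀ Qm : TorusSite 2 L, IsPairClassAt L Qm n →
      ∃ (K : Matrix (TorusSite 2 L × F) (TorusSite 2 L × F) ℂ) (z' : TorusSite 2 L × F → ℂ) (w : TorusSite 2 L → ℝ)
        (TK : Matrix (TorusSite 2 L × F) (TorusSite 2 L × F) ℂ) (m' e₀ eloc : ℝ),
        0 ≤ m' ∧ (∀ x y, ‖K x y‖ ≤ m') ∧ m' * ∑ x, ‖z' x‖ ≤ 1 / 3 ∧ ∑ x, ‖z' x‖ ≤ G.bhi ∧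
        (∀ p, 0 ≤ w p) ∧ ∑ p, w p ≤ G.bhi ∧
        HasSum (fun j : ℕ => K * (-(Matrix.diagonal z' * K)) ^ j) TK ∧
        (∀ k ∈ klBall L μ K₀, ∀ k' ∈ klBall L μ K₀,
          ‖klPairAmplitude L M β U μ K₀ n Qm k k' - TK (k, a₀) (k', a₀)‖ ≤
            drivePBar G P U (n - 1) + e₀ + thermalBar G P U β n +
              legDressBarQ G P Q U n (legSliceCountT L β μ K₀ n ![k', Qm - k', Qm - k, k])) ∧
        (∀ k ∈ klBall L μ K₀, ∀ k' ∈ klBall L μ K₀,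
          ‖K (k, a₀) (k', a₀) - klPairArray L M β U μ K₀ (n - 1) Qm k k'‖ +
            3 / 2 * (2 * |U| + (P.C_W + klLegKappa * Q.CR * P.Klam ^ 3) * U ^ 2) *
              ∑ b, ‖K (k, a₀) b - klPairArray L M β U μ K₀ (n - 1) Qm k b.1‖ * ‖z' b‖ +
            3 / 2 * m' * ∑ a, ‖z' a‖ * ‖K a (k', a₀) - klPairArray L M β U μ K₀ (n - 1) Qm a.1 k'‖ +
            9 / 4 * m' * (2 * |U| + (P.C_W + klLegKappa * Q.CR * P.Klam ^ 3) * U ^ 2) *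
              ∑ a, ∑ b, ‖z' a‖ * ‖K a b - klPairArray L M β U μ K₀ (n - 1) Qm a.1 b.1‖ * ‖z' b‖ ≤ eloc) ∧
        e₀ + eloc + 9 / 4 * (2 * |U| + (P.C_W + klLegKappa * Q.CR * P.Klam ^ 3) * U ^ 2) ^ 2 *
            ∑ p, ‖(∑ b, z' (p, b)) - (w p : ℂ)‖ ≤ eremBar G P Q U β L (n - 1)) :
    PairLadderStepAtV7 L M G P Q β U μ K₀ n :=
  ⟨fun h0 => absurd h0 (by omega), fun _ =>
    klpli_succ_conjunct L M (legSliceCountT L β μ K₀) hsplit hD hsmall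
      (klell_hsup_of_expansion L M (legSliceCountT L β μ K₀) a₀ hsplit hD hsmall hexp)⟩

end Model

end Summit.HubbardSuperconductivity.HubbardSuperconductivity.Theorems.KLRegimeSplit

end
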